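import Literature.Topology.FourManifolds.SimplifiedBrokenLefschetzSidesGenus
import Literature.Topology.FourManifolds.SimplifiedBrokenLefschetzRoundSlicesIndex
import Literature.Topology.FourManifolds.SimplifiedBrokenLefschetzHeight
import Literature.Topology.FourManifolds.SphereHeightFoldCurves
import HarnessLib

/-!
# Round critical points of the base function composed with a genus-one SBLF — stub
# `stub_roundCriticalPoints` of line `Sketch`, crux `SblfDescent.RungOne`

(Crux item stmt-SmoothPoincare4-18531; skeleton `Cruxes/RungOne/Lines/Sketch.lean`.)

Let `f : X → S²` be a genus-one Lefschetz-free simplified broken Lefschetz fibration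
(`IsSimplifiedBrokenLefschetzFibration o f ∅ 0`, Hayano 2011, Def. 2.1 / Baykur–Kamada 2015, §3)
on a closed `4`-manifold whose round image is the equator `{y₂ = 0}`, let `v = (0, 0, ±1)` be the
pole of the torus side (fibres over `{⟪y, v⟫ < 0}` are spheres, over `{⟪y, v⟫ > 0}` tori) and
`ℓ(y) = y₀ (1 + κ ⟪y, v⟫)`, `κ = -1/4`, the base function of the line's six-point Morse function.
We prove: a round point `q` is a critical point of `ℓ ∘ f` iff `(f q)₁ = 0` (i.e.
`f q = (±1, 0, 0)`), and then it is nondegenerate of Morse index `3` over `(1, 0, 0)` and `1`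
over `(-1, 0, 0)`.

Proof (Milnor 1963, §2 in the fold chart of Hayano 2011, Def. 2.1 (4); Baykur 2012, Lemma 7).
In a centred fold chart `(φ, ψ)` at `q` put `Γ = ψ⁻¹ : ℝ² → S² ⊆ ℝ³`, so that
`ℓ ∘ ψ⁻¹ = Γ₀ (1 + κ v₂ Γ₂)`.  By `isMCriticalPt_comp_iff_of_fold_chart`, `q` is critical iff
`∂ₜ(ℓ ∘ ψ⁻¹)(0) = ∂ₜΓ₀(0) = 0` (the axis goes into the equator: `Γ₂ = 0` along it), iff
`Γ₁(0) = (f q)₁ = 0` (`SphereGerm.fderiv_single_zero_zero_eq_zero_iff`).  There, by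
`nondegenerate_and_morseIndex_comp_of_fold_chart`, the index is `[α < 0] + (1 if β > 0 else 2)`
with `α = ∂ₜₜ(ℓ ∘ ψ⁻¹)(0) = ∂ₜₜΓ₀(0) = -Γ₀(0) (∂ₜΓ₁)²` (`SphereGerm.morseData…`; along the axis
`ℓ ∘ ψ⁻¹ = Γ₀`) and `β = ∂ₛ(ℓ ∘ ψ⁻¹)(0) = κ Γ₀(0) · v₂ ∂ₛΓ₂(0)` where `v₂ ∂ₛΓ₂(0) > 0`
(`mul_fderiv_symm_pos_of_fold_chart`: the `s > 0` side of the fold is the torus side).  For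
`Γ₀(0) = 1`: `α < 0`, `β < 0`, index `3`; for `Γ₀(0) = -1`: `α > 0`, `β > 0`, index `1`.

References: J. Milnor, *Morse theory* (1963), §2 [Milnor1963]; K. Hayano, *On genus-1 simplified
broken Lefschetz fibrations*, AGT 11 (2011), Def. 2.1 (4) [Hayano2011]; R. İ. Baykur, *Broken
Lefschetz fibrations and smooth structures on 4-manifolds*, GTM 18 (2012), Lemma 7 [Baykur2012].
-/

set_option linter.dupNamespace false

noncomputable section

open scoped Manifold ContDiff Topology RealInnerProductSpace
open Set Function Literature.Topology.FourManifolds Literature.AlgebraicTopology.SingularHomology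

namespace Summit.SmoothPoincare4.SmoothPoincare4.Cruxes.RungOne.Sketch

/-- Local notation: `𝔼 n` is the model Euclidean space `EuclideanSpace ℝ (Fin n)`. -/
local notation "𝔼 " n:arg => EuclideanSpace ℝ (Fin n)

/-- Local notation: `𝕊²`, the unit sphere of `ℝ³`. -/
local notation "𝕊²" => (Metric.sphere (0 : EuclideanSpace ℝ (Fin 3)) (1 : ℝ))

attribute [local instance] Literature.Topology.FourManifolds.fact_finrank_euclideanSpace_succ

/-- **Derivative of the base function along a curve.**  For a curve `γ` in `ℝ³` with velocity
`γ'` at `t`, the function `s ↦ (γ s)₀ (1 + κ ⟪γ s, v⟫)` has derivative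
`γ'₀ (1 + κ ⟪γ t, v⟫) + (γ t)₀ κ ⟪γ', v⟫` at `t` (product rule). [folklore] -/
private theorem hasDerivAt_apply_zero_mul_one_add_inner {γ : ℝ → 𝔼 3} {γ' : 𝔼 3} {t : ℝ}
    (κ : ℝ) (v : 𝔼 3) (hγ : HasDerivAt γ γ' t) :
    HasDerivAt (fun s => (γ s) 0 * (1 + κ * ⟪γ s, v⟫))
      (γ' 0 * (1 + κ * ⟪γ t, v⟫) + (γ t) 0 * (κ * ⟪γ', v⟫)) t := by
  have h0 : HasDerivAt (fun s => (γ s) 0) (γ' 0) t :=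
    (EuclideanSpace.proj (𝕜 := ℝ) (0 : Fin 3)).hasFDerivAt.comp_hasDerivAt t hγ
  have h1 : HasDerivAt (fun s => 1 + κ * ⟪γ s, v⟫) (κ * ⟪γ', v⟫) t := by
    have h := ((hγ.inner (𝕜 := ℝ) (hasDerivAt_const t v)).const_mul κ).const_add 1
    simpa using h
  exact h0.mul h1

/-- **The base function is smooth on the sphere**: `y ↦ y₀ (1 + κ ⟪y, v⟫)` is the restriction of
a polynomial on `ℝ³`. [folklore] -/
private theorem contMDiff_baseFunction (κ : ℝ) (v : 𝔼 3) :
    ContMDiff (𝓡 2) 𝓘(ℝ, ℝ) ∞ (fun y : 𝕊² => (y : 𝔼 3) 0 * (1 + κ * ⟪(y : 𝔼 3), v⟫)) := by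
  have hP : ContDiff ℝ ∞ (fun x : 𝔼 3 => x 0 * (1 + κ * ⟪x, v⟫)) :=
    (contDiff_piLp_apply (p := 2) (i := (0 : Fin 3))).mul
      (contDiff_const.add (contDiff_const.mul (contDiff_id.inner ℝ contDiff_const)))
  exact hP.comp_contMDiff contMDiff_coe_sphere

/-- **Round critical points of `ℓ ∘ f`.**  For a genus-one Lefschetz-free SBLF `f` on a closed
`X` with equatorial round image and torus-side pole `v` (sphere-side fibres have `H₁ = 0`,
torus-side fibres `H₁ ≅ ℤ²`), a round point `q` is critical for `ℓ ∘ f`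
(`ℓ(y) = y₀ (1 - ¼⟪y, v⟫)`) iff `(f q)₁ = 0`, i.e. `f q = (±1, 0, 0)`; there it is nondegenerate,
of index `3` over `(1, 0, 0)` (tangential maximum of `ℓ|equator = y₀`, and `ℓ` increases into the
sphere side: Hessian `diag(α, 2β, 2β, -2β)` with `α, β < 0` in the fold chart) and of index `1` over
`(-1, 0, 0)` (`α, β > 0`).  Inputs: `nondegenerate_and_morseIndex_comp_of_fold_chart`,
`mul_fderiv_symm_pos_of_fold_chart`, and the computation of `round_point_height`.
[cite: Milnor1963, §2] [cite: Hayano2011, Def. 2.1 (4)] [cite: Baykur2012, Lemma 7] -/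
theorem stub_roundCriticalPoints :
    ∀ (X : Type) [TopologicalSpace X] [T2Space X] [SecondCountableTopology X] [CompactSpace X]
      [ChartedSpace (𝔼 4) X] [IsManifold (𝓡 4) ∞ X]
      (o : SmoothOrientation (𝓡 4) X) (f : X → 𝕊²),
      IsSimplifiedBrokenLefschetzFibration o f ∅ 0 →
      f '' ({p : X | ¬ Surjective (mfderiv (𝓡 4) (𝓡 2) f p)} \ (↑(∅ : Finset X) : Set X)) =
        sphereEquator 1 →
      ∀ (v : 𝕊²), (v : 𝔼 3) 0 = 0 → (v : 𝔼 3) 1 = 0 →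
      (∀ y : 𝕊², ⟪(y : 𝔼 3), (v : 𝔼 3)⟫ < 0 →
        (∀ q, f q = y → Surjective (mfderiv (𝓡 4) (𝓡 2) f q)) ∧
        Nonempty ((Fin (2 * 0) → ℤ) ≃ₗ[ℤ] singularHomology ℤ ℤ ↥(f ⁻¹' {y}) 1)) →
      (∀ y : 𝕊², ⟪(y : 𝔼 3), ((-v : 𝕊²) : 𝔼 3)⟫ < 0 →
        (∀ q, f q = y → Surjective (mfderiv (𝓡 4) (𝓡 2) f q)) ∧
        Nonempty ((Fin (2 * (0 + 1)) → ℤ) ≃ₗ[ℤ] singularHomology ℤ ℤ ↥(f ⁻¹' {y}) 1)) →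
      ∀ ℓ : 𝕊² → ℝ, ℓ = (fun y : 𝕊² => (y : 𝔼 3) 0 * (1 + (-(1 / 4 : ℝ)) * ⟪(y : 𝔼 3), (v : 𝔼 3)⟫)) →
      ∀ q : X, ¬ Surjective (mfderiv (𝓡 4) (𝓡 2) f q) →
        (IsMCriticalPt (𝓡 4) (ℓ ∘ f) q ↔ ((f q : 𝕊²) : 𝔼 3) 1 = 0) ∧
        (((f q : 𝕊²) : 𝔼 3) 1 = 0 → (mhessian (𝓡 4) (ℓ ∘ f) q).Nondegenerate ∧
          morseIndex (𝓡 4) (ℓ ∘ f) q = if 0 < ((f q : 𝕊²) : 𝔼 3) 0 then 3 else 1) := by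
  intro X _ _ _ _ _ _ o f hf hC v hv0 hv1 hlo hhi ℓ hℓ q hq
  subst hℓ
  -- smoothness of the base function
  have hℓs : ContMDiff (𝓡 2) 𝓘(ℝ, ℝ) ∞
      (fun y : 𝕊² => (y : 𝔼 3) 0 * (1 + (-(1 / 4 : ℝ)) * ⟪(y : 𝔼 3), (v : 𝔼 3)⟫)) :=
    contMDiff_baseFunction _ _
  -- the centred fold chart at `q` and the germ `Γ = ψ⁻¹ : ℝ² → S² ⊆ ℝ³`
  obtain ⟨φ, ψ, hqφ, hφ0, hmaps, hφ, hφs, hψ, hψs, hmodel⟩ := hf.fold q hq (by simp)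
  obtain ⟨hΓ, hS, hE, hinj, hΓ0⟩ :=
    hf.sphereGerm_of_fold_chart hC hqφ hφ0 hmaps hφ hφs hψ hψs hmodel
  have hpos_of : ((f q : 𝕊²) : 𝔼 3) 1 = 0 → 0 < (v : 𝔼 3) 2 *
      fderiv ℝ (fun w => ((ψ.symm w : 𝕊²) : 𝔼 3)) 0 (EuclideanSpace.single (1 : Fin 2) (1 : ℝ)) 2 :=
    fun hq1 => hf.mul_fderiv_symm_pos_of_fold_chart hC hv0 hv1 hlo hhi hq1 hqφ hφ0 hmaps hφ hφs
      hψ hψs hmodel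
  set Γ : 𝔼 2 → 𝔼 3 := fun w => ((ψ.symm w : 𝕊²) : 𝔼 3) with hΓdef
  set e₀ : 𝔼 2 := EuclideanSpace.single (0 : Fin 2) (1 : ℝ) with he₀
  set e₁ : 𝔼 2 := EuclideanSpace.single (1 : Fin 2) (1 : ℝ) with he₁
  have haxis : (φ q) 1 = 0 ∧ (φ q) 2 = 0 ∧ (φ q) 3 = 0 := by rw [hφ0]; simp
  have hψ0 : ψ (f q) = 0 :=
    IsSimplifiedBrokenLefschetzFibration.base_apply_eq_zero_of_fold_chart hmodel hqφ hφ0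
  have h0t : (0 : 𝔼 2) ∈ ψ.target := hψ0 ▸ ψ.map_source (hmaps hqφ)
  -- `F = ℓ ∘ ψ⁻¹ = Γ₀ (1 + κ ⟪Γ, v⟫)`
  set F : 𝔼 2 → ℝ :=
    (fun y : 𝕊² => (y : 𝔼 3) 0 * (1 + (-(1 / 4 : ℝ)) * ⟪(y : 𝔼 3), (v : 𝔼 3)⟫)) ∘ ψ.symm with hFdef
  have hFs : ContDiffAt ℝ ∞ F 0 := contDiffAt_comp_symm_of_chart hψs hℓs h0t
  have hF2 : ContDiffAt ℝ 2 F 0 := hFs.of_le (by norm_cast)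
  have hΓd : DifferentiableAt ℝ Γ 0 := hΓ.differentiableAt (by simp)
  -- the curves `s ↦ Γ (s • d)`
  have hγ : ∀ d : 𝔼 2, HasDerivAt (fun s : ℝ => Γ (s • d)) (fderiv ℝ Γ 0 d) 0 := fun d => by
    have hd0 : DifferentiableAt ℝ Γ ((0 : ℝ) • d) := by rw [zero_smul]; exact hΓd
    simpa using SphereGerm.hasDerivAt_comp_smul d hd0
  -- coordinates: `Γ 0 = f q` lies on the equator, `v = (0, 0, v₂)`
  have hΓ02 : Γ 0 2 = 0 := SphereGerm.apply_zero_two hE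
  have hinnerD : ∀ w : 𝔼 3, ⟪w, (v : 𝔼 3)⟫ = w 2 * (v : 𝔼 3) 2 := fun w => by
    rw [BandFoliation.inner_eq_three, hv0, hv1]; ring
  have hinner0 : ⟪Γ 0, (v : 𝔼 3)⟫ = 0 := by rw [hinnerD, hΓ02, zero_mul]
  -- first derivatives of `F` at `0`
  have hF1 : ∀ d : 𝔼 2, fderiv ℝ F 0 d =
      (fderiv ℝ Γ 0 d) 0 + (Γ 0) 0 * ((-(1 / 4 : ℝ)) * ((fderiv ℝ Γ 0 d) 2 * (v : 𝔼 3) 2)) := by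
    intro d
    have hFd : DifferentiableAt ℝ F ((0 : ℝ) • d) := by
      rw [zero_smul]; exact hFs.differentiableAt (by simp)
    have h1 := deriv_comp_smul_const hFd
    rw [zero_smul] at h1
    have hline : HasDerivAt (fun s : ℝ => F (s • d))
        ((fderiv ℝ Γ 0 d) 0 * (1 + (-(1 / 4 : ℝ)) * ⟪Γ ((0 : ℝ) • d), (v : 𝔼 3)⟫) +
          (Γ ((0 : ℝ) • d)) 0 * ((-(1 / 4 : ℝ)) * ⟪fderiv ℝ Γ 0 d, (v : 𝔼 3)⟫)) 0 :=
      hasDerivAt_apply_zero_mul_one_add_inner (-(1 / 4 : ℝ)) (v : 𝔼 3) (hγ d)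
    rw [← h1, hline.deriv, zero_smul, hinner0, hinnerD]
    ring
  have hT2 : fderiv ℝ Γ 0 e₀ 2 = 0 := SphereGerm.fderiv_single_zero_two hΓ hE
  have hFe₀ : fderiv ℝ F 0 e₀ = fderiv ℝ Γ 0 e₀ 0 := by rw [hF1, hT2]; ring
  -- (a) criticality: only `∂ₜ Γ₀ (0)` survives, and it vanishes iff `Γ₁ (0) = (f q)₁ = 0`
  have hcrit_iff : IsMCriticalPt (𝓡 4)
      ((fun y : 𝕊² => (y : 𝔼 3) 0 * (1 + (-(1 / 4 : ℝ)) * ⟪(y : 𝔼 3), (v : 𝔼 3)⟫)) ∘ f) q ↔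
        ((f q : 𝕊²) : 𝔼 3) 1 = 0 := by
    rw [isMCriticalPt_comp_iff_of_fold_chart hmaps hφ hφs hψs hmodel hf.contMDiff hℓs hqφ haxis,
      hψ0]
    change fderiv ℝ F 0 e₀ = 0 ↔ _
    rw [hFe₀, SphereGerm.fderiv_single_zero_zero_eq_zero_iff hΓ hS hE hinj]
    change ((ψ.symm 0 : 𝕊²) : 𝔼 3) 1 = 0 ↔ _
    rw [hΓ0]
  refine ⟨hcrit_iff, fun hq1 => ?_⟩
  -- (b) the index at a critical round point
  have hcrit := hcrit_iff.2 hq1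
  have hΓ01 : Γ 0 1 = 0 := by
    change ((ψ.symm 0 : 𝕊²) : 𝔼 3) 1 = 0
    rw [hΓ0]; exact hq1
  have hT0 : fderiv ℝ Γ 0 e₀ 0 = 0 :=
    (SphereGerm.fderiv_single_zero_zero_eq_zero_iff hΓ hS hE hinj).2 hΓ01
  obtain ⟨hpm, hT1, hsec, hV0, -⟩ :=
    SphereGerm.morseData_of_fderiv_single_zero_zero_eq_zero hΓ hS hE hinj hT0
  have hpos : 0 < (v : 𝔼 3) 2 * fderiv ℝ Γ 0 e₁ 2 := hpos_of hq1
  -- `β = ∂ₛ F (0) = κ Γ₀(0) · v₂ ∂ₛΓ₂(0)`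
  have hβ : fderiv ℝ F 0 e₁ = (-(1 / 4 : ℝ)) * (Γ 0 0) * ((v : 𝔼 3) 2 * fderiv ℝ Γ 0 e₁ 2) := by
    rw [hF1, hV0]; ring
  -- `α = ∂ₜₜ F (0) = ∂ₜₜ Γ₀ (0) = -Γ₀(0) (∂ₜΓ₁)²`: along the axis `F = Γ₀`
  have hα : fderiv ℝ (fderiv ℝ F) 0 e₀ e₀ = -(Γ 0 0) * (fderiv ℝ Γ 0 e₀ 1) ^ 2 := by
    set G : 𝔼 2 → ℝ :=
      (innerSL ℝ (EuclideanSpace.single (0 : Fin 3) (1 : ℝ)) : 𝔼 3 →L[ℝ] ℝ) ∘ Γ with hGdef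
    have hG2 : ContDiffAt ℝ 2 G 0 :=
      (innerSL ℝ (EuclideanSpace.single (0 : Fin 3) (1 : ℝ)) :
        𝔼 3 →L[ℝ] ℝ).contDiff.contDiffAt.comp 0 hΓ
    have hev : (fun s : ℝ => F (s • e₀)) =ᶠ[𝓝 0] fun s : ℝ => G (s • e₀) := by
      filter_upwards [hE] with s hs
      change (Γ (s • e₀)) 0 * (1 + (-(1 / 4 : ℝ)) * ⟪Γ (s • e₀), (v : 𝔼 3)⟫) =
        innerSL ℝ (EuclideanSpace.single (0 : Fin 3) (1 : ℝ)) (Γ (s • e₀))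
      rw [innerSL_apply_apply, ← apply_eq_inner_single, hinnerD, hs]
      ring
    rw [← deriv_deriv_comp_smul_const hF2, hev.deriv.deriv_eq, deriv_deriv_comp_smul_const hG2,
      hGdef, IsSimplifiedBrokenLefschetzFibration.fderiv_fderiv_inner_comp_apply _ hΓ,
      ← apply_eq_inner_single, hsec]
  -- the chart quantities of `nondegenerate_and_morseIndex_comp_of_fold_chart`
  have hΓ00 : Γ 0 0 ≠ 0 := by rcases hpm with h1 | h1 <;> rw [h1] <;> norm_num
  have hT1sq : 0 < (fderiv ℝ Γ 0 e₀ 1) ^ 2 := by positivity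
  have hκ : (-(1 / 4 : ℝ)) ≠ 0 := by norm_num
  have hαne : fderiv ℝ (fderiv ℝ F) (ψ (f q)) e₀ e₀ ≠ 0 := by
    rw [hψ0, hα]
    exact mul_ne_zero (neg_ne_zero.2 hΓ00) hT1sq.ne'
  have hβne : fderiv ℝ F (ψ (f q)) e₁ ≠ 0 := by
    rw [hψ0, hβ]
    exact mul_ne_zero (mul_ne_zero hκ hΓ00) hpos.ne'
  obtain ⟨hnd, hidx⟩ := nondegenerate_and_morseIndex_comp_of_fold_chart hmaps hφ hφs hψs hmodel
    hf.contMDiff hℓs hqφ haxis hcrit hαne hβne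
  refine ⟨hnd, ?_⟩
  have hx0 : ((f q : 𝕊²) : 𝔼 3) 0 = Γ 0 0 := by
    change ((f q : 𝕊²) : 𝔼 3) 0 = ((ψ.symm 0 : 𝕊²) : 𝔼 3) 0
    rw [hΓ0]
  rw [hidx, hx0]
  change (if fderiv ℝ (fderiv ℝ F) (ψ (f q)) e₀ e₀ < 0 then 1 else 0) +
      (if 0 < fderiv ℝ F (ψ (f q)) e₁ then 1 else 2) = if 0 < Γ 0 0 then 3 else 1
  rw [hψ0, hα, hβ]
  rcases hpm with h1 | h1
  · -- over `(1, 0, 0)`: `α < 0`, `β < 0`, index `1 + 2 = 3`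
    have hαneg : -(Γ 0 0) * (fderiv ℝ Γ 0 e₀ 1) ^ 2 < 0 := by rw [h1]; linarith
    have hβneg : ¬ 0 < (-(1 / 4 : ℝ)) * (Γ 0 0) * ((v : 𝔼 3) 2 * fderiv ℝ Γ 0 e₁ 2) := by
      rw [h1]; linarith
    rw [if_pos hαneg, if_neg hβneg, h1, if_pos one_pos]
  · -- over `(-1, 0, 0)`: `α > 0`, `β > 0`, index `0 + 1 = 1`
    have hαpos : ¬ -(Γ 0 0) * (fderiv ℝ Γ 0 e₀ 1) ^ 2 < 0 := by rw [h1]; linarith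
    have hβpos : 0 < (-(1 / 4 : ℝ)) * (Γ 0 0) * ((v : 𝔼 3) 2 * fderiv ℝ Γ 0 e₁ 2) := by
      rw [h1]; linarith
    rw [if_neg hαpos, if_pos hβpos, h1, if_neg (by norm_num : ¬ (0 : ℝ) < -1)]

end Summit.SmoothPoincare4.SmoothPoincare4.Cruxes.RungOne.Sketch

end
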